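import Mathlib
import Summits.NavierStokesRegularity.FluidComputer.WobblingBeltramiHost
import HarnessLib

/-!
# Time-dependent Beltrami-shell hosts are exact forced solutions (class (III) of the X1″ ledger),
# and the shell's `e^{−νλ̄²t}` directions survive every modulation

HONEST FRAMING (cell `ns-blowup`, seat `ns-blowup-refuter`, human ruling D-0035): nothing here is a
claim about Navier–Stokes blow-up. WHAT THIS IS NOT: not a statement about the marginal tower N1*;
it is the kernel form of two EXACT facts used by the refuter's K-check of the class-(III) host of
record (`KILLSHEET.md` §XIX.9 (5), §XIX.11; STATUS K-CHECK PRE-READ of `instab/P-X1pp-B-PREREG-DRAFT.md`):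

* §1 (`isClassicalNSSolutionOn_shellHost`) **every jointly smooth time-dependent family `U t` of
  divergence-free strong Beltrami fields with one constant coefficient `λ̄` is an exact classical
  solution** of the forced Navier–Stokes system on `ℝ³ × ℝ` with force `f = ∂ₜU + νλ̄²U` and
  pressure `p = −½|U|²` (each slice has `(U·∇)U = ∇½|U|²` and `νΔU = −νλ̄²U`; the force supplies
  `∂ₜU` and the viscous loss). Since `curl f = ∂ₜ(curl U) + νλ̄² curl U ≠` a gradient in general, such
  hosts are NON-MATERIAL (their vortex lines are not frozen in) unless `∂ₜU ≡ 0` — the class-(III)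
  bookkeeping sentence of §XIX.9 (5).
* §2 (`isClassicalNSSolutionOn_shellHost_add_decay`) **the `−νλ̄²` directions are exact for every
  modulation**: for any steady member `S` of the same shell, `U t + e^{−νλ̄²t} S` solves the system with
  the SAME force `∂ₜU + νλ̄²U` — so the Floquet multiplier of the shell directions about ANY
  time-periodic shell host is exactly `e^{−νλ̄²T}` (the engine check «sextuplet multiplier `e^{−νT}`»
  of the class-(III) pre-registration, valid for all modulation depths `δ`).
* §3 (`timeDerivWithin_abc_coeff`, `isClassicalNSSolutionOn_abc_coeff`,
  `isClassicalNSSolutionOn_abc_coeff_add_decay`) the ABC instance with arbitrary smooth coefficient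
  functions `A B C : ℝ → ℝ` (`λ̄ = 1`): `abc (A t) (B t) (C t)` is exact with force
  `abc (A' t) (B' t) (C' t) + ν · abc (A t) (B t) (C t)` — in particular the breathing host
  `A, B, C = 1 + δ cos(Ωt + 2πj/3)` of the draft pre-registration P-X1″-B (H1).

All statements are pointwise identities over the tree's `IsClassicalNSSolutionOn`, `IsBeltrami`,
`timeDerivWithin`, `convect`, `gradient`; no spectral claim beyond the explicit exact solutions.
References: Majda–Bertozzi 2002 §2.3.2 (Beltrami flows, Prop. 2.12 and the remark before it);
cell files `KILLSHEET.md` §XIX.9/§XIX.11, `instab/P-X1pp-B-PREREG-DRAFT.md` H1/H6.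
-/

noncomputable section

open Set Real InnerProductSpace Function
open scoped RealInnerProductSpace ContDiff Laplacian Topology

namespace Summit.NavierStokesRegularity.FluidComputer.TimeDependentShellHost

open Literature.Analysis.FluidPDE Literature.Analysis.FluidPDE.ABC BeltramiHostLinearisation

local notation "ℝ³" => EuclideanSpace ℝ (Fin 3)
local notation "𝐞" j => EuclideanSpace.single (j : Fin 3) (1 : ℝ)

/-! ### §1 Time-dependent shell hosts -/

/-- A jointly smooth time-dependent field has smooth time slices. -/
theorem contDiff_slice {U : ℝ → ℝ³ → ℝ³} (hUs : ContDiff ℝ ∞ (uncurry U)) (t : ℝ) :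
    ContDiff ℝ ∞ (U t) :=
  hUs.comp (contDiff_const.prodMk contDiff_id)

/-- A jointly smooth time-dependent field has differentiable time lines `s ↦ U s x`. -/
theorem differentiableAt_time {U : ℝ → ℝ³ → ℝ³} (hUs : ContDiff ℝ ∞ (uncurry U)) (t : ℝ) (x : ℝ³) :
    DifferentiableAt ℝ (fun s => U s x) t :=
  ((hUs.differentiable (by simp)).comp (differentiable_id.prodMk (differentiable_const x))) t

/-- **Time-dependent Beltrami-shell hosts are exact.** Let `U : ℝ → ℝ³ → ℝ³` be jointly smooth with
every slice `U t` a divergence-free strong Beltrami field of the same constant coefficient `λ̄`.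
Then `u = U`, `p = −½|U|²` is a classical solution on `ℝ³ × ℝ` of the Navier–Stokes system with
viscosity `ν` and force `f(t,x) = ∂ₜU(t,x) + νλ̄²U(t,x)`. -/
theorem isClassicalNSSolutionOn_shellHost {U : ℝ → ℝ³ → ℝ³} {lam0 : ℝ} (ν : ℝ)
    (hU : ∀ t, IsBeltrami (U t) fun _ => lam0) (hUs : ContDiff ℝ ∞ (uncurry U))
    (hUdiv : ∀ t, VectorCalculus.IsDivFree (U t)) :
    IsClassicalNSSolutionOn univ ν
      (fun t x => timeDerivWithin univ U t x + (ν * lam0 ^ 2) • U t x)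
      U (fun t x => -(‖U t x‖ ^ 2 / 2)) := by
  refine ⟨hUs.contDiffOn, (((hUs.norm_sq ℝ).div_const 2).neg).contDiffOn, ?_, ?_⟩
  · -- the momentum equation, slice by slice
    intro t _ x
    have hUts : ContDiff ℝ ∞ (U t) := contDiff_slice hUs t
    have hUt2 : ContDiff ℝ 2 (U t) := contDiff_infty.1 hUts 2
    have hUtd : Differentiable ℝ (U t) := hUts.differentiable (by simp)
    -- convective term
    have h2 : convect (U t) (U t) x = gradient (fun y => ‖U t y‖ ^ 2 / 2) x :=
      (hU t).convect_eq_gradient (hUtd x)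
    -- viscous term
    have h3 : Δ (U t) x = -(lam0 ^ 2) • U t x :=
      laplacian_eq_of_strongBeltrami (hU t) hUt2 (hUdiv t) x
    -- pressure gradient
    have h4 : gradient (fun y => -(‖U t y‖ ^ 2 / 2)) x = -gradient (fun y => ‖U t y‖ ^ 2 / 2) x := by
      simp only [gradient, fderiv_fun_neg, map_neg]
    show timeDerivWithin univ U t x + convect (U t) (U t) x =
      ν • Δ (U t) x - gradient (fun y => -(‖U t y‖ ^ 2 / 2)) x +
        (timeDerivWithin univ U t x + (ν * lam0 ^ 2) • U t x)
    rw [h2, h3, h4]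
    ext i
    simp only [PiLp.add_apply, PiLp.sub_apply, PiLp.neg_apply, PiLp.smul_apply, smul_eq_mul]
    ring
  · -- incompressibility
    intro t _
    exact hUdiv t

/-- The Euler form (`ν = 0`): a time-dependent shell host is an exact Euler solution with force
`∂ₜU` — it is unforced iff it is steady. -/
theorem isClassicalEulerSolutionOn_shellHost {U : ℝ → ℝ³ → ℝ³} {lam0 : ℝ}
    (hU : ∀ t, IsBeltrami (U t) fun _ => lam0) (hUs : ContDiff ℝ ∞ (uncurry U))
    (hUdiv : ∀ t, VectorCalculus.IsDivFree (U t)) :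
    IsClassicalEulerSolutionOn univ (fun t x => timeDerivWithin univ U t x)
      U (fun t x => -(‖U t x‖ ^ 2 / 2)) := by
  have h := isClassicalNSSolutionOn_shellHost 0 hU hUs hUdiv
  simp only [zero_mul, zero_smul, add_zero] at h
  exact h

/-! ### §2 The shell's decaying directions survive every modulation -/

/-- Time derivative of `U t x + e^{ct} S x` along a time line. -/
theorem timeDerivWithin_add_decay {U : ℝ → ℝ³ → ℝ³} (hUs : ContDiff ℝ ∞ (uncurry U))
    (S : ℝ³ → ℝ³) (c t : ℝ) (x : ℝ³) :
    timeDerivWithin univ (fun s y => U s y + exp (c * s) • S y) t x =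
      timeDerivWithin univ U t x + (exp (c * t) * c) • S x := by
  rw [timeDerivWithin_apply, timeDerivWithin_apply, derivWithin_univ, derivWithin_univ]
  have hU' : HasDerivAt (fun s => U s x) (deriv (fun s => U s x) t) t :=
    (differentiableAt_time hUs t x).hasDerivAt
  have hE0 : HasDerivAt (fun s : ℝ => c * s) c t := by
    simpa using (hasDerivAt_id t).const_mul c
  have hE : HasDerivAt (fun s : ℝ => exp (c * s) • S x) ((exp (c * t) * c) • S x) t :=
    hE0.exp.smul_const (S x)
  exact (hU'.add hE).deriv

/-- **The `−νλ̄²` directions are exact about every time-dependent shell host.** With `U` as in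
`isClassicalNSSolutionOn_shellHost` and `S` a steady smooth divergence-free member of the same shell,
`u(t,x) = U(t,x) + e^{−νλ̄²t} S(x)`, `p = −½|u|²` solves the system with the SAME force
`∂ₜU + νλ̄²U`: the perturbation `e^{−νλ̄²t} S` is an exact solution of the dynamics linearised (indeed:
un-linearised) about the modulated host, for every amplitude — Floquet multiplier `e^{−νλ̄²T}` about
any `T`-periodic shell host. -/
theorem isClassicalNSSolutionOn_shellHost_add_decay {U : ℝ → ℝ³ → ℝ³} {S : ℝ³ → ℝ³} {lam0 : ℝ}
    (ν : ℝ) (hU : ∀ t, IsBeltrami (U t) fun _ => lam0) (hUs : ContDiff ℝ ∞ (uncurry U))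
    (hUdiv : ∀ t, VectorCalculus.IsDivFree (U t)) (hS : IsBeltrami S fun _ => lam0)
    (hSs : ContDiff ℝ ∞ S) (hSdiv : VectorCalculus.IsDivFree S) :
    IsClassicalNSSolutionOn univ ν
      (fun t x => timeDerivWithin univ U t x + (ν * lam0 ^ 2) • U t x)
      (fun t x => U t x + exp (-(lam0 ^ 2 * ν) * t) • S x)
      (fun t x => -(‖U t x + exp (-(lam0 ^ 2 * ν) * t) • S x‖ ^ 2 / 2)) := by
  set c : ℝ := -(lam0 ^ 2 * ν) with hc
  have hSd : Differentiable ℝ S := hSs.differentiable (by simp)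
  -- the modulated family `U' t = U t + e^{ct} S` is again a jointly smooth shell family
  have hU's : ContDiff ℝ ∞ (uncurry fun t x => U t x + exp (c * t) • S x) := by
    have h1 : ContDiff ℝ ∞ (fun q : ℝ × ℝ³ => exp (c * q.1) • S q.2) :=
      (contDiff_exp.comp (contDiff_const.mul contDiff_fst)).smul (hSs.comp contDiff_snd)
    exact hUs.add h1
  have hU' : ∀ t, IsBeltrami (fun x => U t x + exp (c * t) • S x) fun _ => lam0 := fun t =>
    (hU t).add (hS.const_smul hSd (exp (c * t))) ((contDiff_slice hUs t).differentiable (by simp))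
      (hSd.const_smul (exp (c * t)))
  have hU'div : ∀ t, VectorCalculus.IsDivFree (fun x => U t x + exp (c * t) • S x) := by
    intro t x
    have hUtd : DifferentiableAt ℝ (U t) x := ((contDiff_slice hUs t).differentiable (by simp)) x
    have hg : DifferentiableAt ℝ (fun y => exp (c * t) • S y) x := (hSd x).const_smul (exp (c * t))
    unfold VectorCalculus.divergence
    rw [fderiv_fun_add hUtd hg, fderiv_fun_const_smul (hSd x)]
    have h1 := hUdiv t x
    have h2 := hSdiv x
    unfold VectorCalculus.divergence at h1 h2
    simp [h1, h2]
  have h := isClassicalNSSolutionOn_shellHost ν hU' hU's hU'div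
  -- the force of the modulated family equals the force of the host: the decay rate cancels `νλ̄²`
  have hf : (fun t x => timeDerivWithin univ (fun s y => U s y + exp (c * s) • S y) t x +
        (ν * lam0 ^ 2) • (U t x + exp (c * t) • S x)) =
      fun t x => timeDerivWithin univ U t x + (ν * lam0 ^ 2) • U t x := by
    funext t x
    rw [timeDerivWithin_add_decay hUs S c t x, hc]
    ext i
    simp only [PiLp.add_apply, PiLp.smul_apply, smul_eq_mul]
    ring
  rw [hf] at h
  exact h

/-! ### §3 The ABC instance with time-dependent coefficients (`λ̄ = 1`) -/

/-- Component form of the ABC field with coefficients `A, B, C` at a point (local copy of the tree's `abc`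
unfolding, kept private). -/
private theorem abc_eq' (A B C : ℝ) (x : ℝ³) :
    abc A B C x = (A * sin (x 2) + C * cos (x 1)) • (𝐞 0) + (B * sin (x 0) + A * cos (x 2)) • (𝐞 1) +
      (C * sin (x 1) + B * cos (x 0)) • (𝐞 2) := by
  ext i
  fin_cases i <;> simp

/-- Joint smoothness of `(t, x) ↦ abc (A t) (B t) (C t) x` for smooth coefficient functions. -/
theorem contDiff_uncurry_abc_coeff {A B C : ℝ → ℝ} (hA : ContDiff ℝ ∞ A) (hB : ContDiff ℝ ∞ B)
    (hC : ContDiff ℝ ∞ C) : ContDiff ℝ ∞ (uncurry fun t x => abc (A t) (B t) (C t) x) := by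
  have hc : ∀ j : Fin 3, ContDiff ℝ ∞ (fun q : ℝ × ℝ³ => q.2 j) := fun j =>
    (EuclideanSpace.proj j : ℝ³ →L[ℝ] ℝ).contDiff.comp contDiff_snd
  have hA' : ContDiff ℝ ∞ (fun q : ℝ × ℝ³ => A q.1) := hA.comp contDiff_fst
  have hB' : ContDiff ℝ ∞ (fun q : ℝ × ℝ³ => B q.1) := hB.comp contDiff_fst
  have hC' : ContDiff ℝ ∞ (fun q : ℝ × ℝ³ => C q.1) := hC.comp contDiff_fst
  have e : (uncurry fun t x => abc (A t) (B t) (C t) x) = fun q : ℝ × ℝ³ =>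
      (A q.1 * sin (q.2 2) + C q.1 * cos (q.2 1)) • (𝐞 0) +
      (B q.1 * sin (q.2 0) + A q.1 * cos (q.2 2)) • (𝐞 1) +
      (C q.1 * sin (q.2 1) + B q.1 * cos (q.2 0)) • (𝐞 2) := by
    funext q
    exact abc_eq' (A q.1) (B q.1) (C q.1) q.2
  rw [e]
  exact ((((hA'.mul (hc 2).sin).add (hC'.mul (hc 1).cos)).smul contDiff_const).add
    (((hB'.mul (hc 0).sin).add (hA'.mul (hc 2).cos)).smul contDiff_const)).add
    (((hC'.mul (hc 1).sin).add (hB'.mul (hc 0).cos)).smul contDiff_const)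

/-- `∂ₜ abc (A t) (B t) (C t) x = abc (A' t) (B' t) (C' t) x` (linearity in the coefficients). -/
theorem timeDerivWithin_abc_coeff {A B C : ℝ → ℝ} (hA : ContDiff ℝ ∞ A) (hB : ContDiff ℝ ∞ B)
    (hC : ContDiff ℝ ∞ C) (t : ℝ) (x : ℝ³) :
    timeDerivWithin univ (fun s y => abc (A s) (B s) (C s) y) t x =
      abc (deriv A t) (deriv B t) (deriv C t) x := by
  rw [timeDerivWithin_apply, derivWithin_univ]
  have hA' : HasDerivAt A (deriv A t) t := ((hA.differentiable (by simp)) t).hasDerivAt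
  have hB' : HasDerivAt B (deriv B t) t := ((hB.differentiable (by simp)) t).hasDerivAt
  have hC' : HasDerivAt C (deriv C t) t := ((hC.differentiable (by simp)) t).hasDerivAt
  have e : (fun s => abc (A s) (B s) (C s) x) = fun s =>
      (A s * sin (x 2) + C s * cos (x 1)) • (𝐞 0) + (B s * sin (x 0) + A s * cos (x 2)) • (𝐞 1) +
      (C s * sin (x 1) + B s * cos (x 0)) • (𝐞 2) := funext fun s => abc_eq' (A s) (B s) (C s) x
  rw [e, abc_eq']
  exact (((((hA'.mul_const _).add (hC'.mul_const _)).smul_const _).add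
    (((hB'.mul_const _).add (hA'.mul_const _)).smul_const _)).add
    (((hC'.mul_const _).add (hB'.mul_const _)).smul_const _)).deriv

/-- **Class-(III) ABC hosts are exact.** For smooth coefficient functions `A B C : ℝ → ℝ`,
`u(t,x) = abc (A t) (B t) (C t) x`, `p = −½|u|²` is a classical solution on `ℝ³ × ℝ` with force
`abc (A' t) (B' t) (C' t) x + ν · abc (A t) (B t) (C t) x`. The breathing host of the draft
pre-registration P-X1″-B is `A, B, C = 1 + δ cos(Ωt + 2πj/3)`, `j = 0, 1, 2`. -/
theorem isClassicalNSSolutionOn_abc_coeff (ν : ℝ) {A B C : ℝ → ℝ} (hA : ContDiff ℝ ∞ A)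
    (hB : ContDiff ℝ ∞ B) (hC : ContDiff ℝ ∞ C) :
    IsClassicalNSSolutionOn univ ν
      (fun t x => abc (deriv A t) (deriv B t) (deriv C t) x + ν • abc (A t) (B t) (C t) x)
      (fun t x => abc (A t) (B t) (C t) x)
      (fun t x => -(‖abc (A t) (B t) (C t) x‖ ^ 2 / 2)) := by
  have h := isClassicalNSSolutionOn_shellHost ν (U := fun t x => abc (A t) (B t) (C t) x)
    (fun t => isBeltrami_abc _ _ _) (contDiff_uncurry_abc_coeff hA hB hC)
    (fun t => isDivFree_abc _ _ _)
  have hf : (fun t x => timeDerivWithin univ (fun s y => abc (A s) (B s) (C s) y) t x +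
        (ν * (1 : ℝ) ^ 2) • abc (A t) (B t) (C t) x) =
      fun t x => abc (deriv A t) (deriv B t) (deriv C t) x + ν • abc (A t) (B t) (C t) x := by
    funext t x
    rw [timeDerivWithin_abc_coeff hA hB hC, one_pow, mul_one]
  rw [hf] at h
  exact h

/-- **… and their shell directions decay at exactly `e^{−νt}`** (engine check of the class-(III)
pre-registration): for any steady ABC member `abc A₁ B₁ C₁` (e.g. the other five members of the
`𝔅`-sextuplet), `abc (A t) (B t) (C t) + e^{−νt} abc A₁ B₁ C₁` solves the system with the same force. -/
theorem isClassicalNSSolutionOn_abc_coeff_add_decay (ν A₁ B₁ C₁ : ℝ) {A B C : ℝ → ℝ}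
    (hA : ContDiff ℝ ∞ A) (hB : ContDiff ℝ ∞ B) (hC : ContDiff ℝ ∞ C) :
    IsClassicalNSSolutionOn univ ν
      (fun t x => abc (deriv A t) (deriv B t) (deriv C t) x + ν • abc (A t) (B t) (C t) x)
      (fun t x => abc (A t) (B t) (C t) x + exp (-ν * t) • abc A₁ B₁ C₁ x)
      (fun t x => -(‖abc (A t) (B t) (C t) x + exp (-ν * t) • abc A₁ B₁ C₁ x‖ ^ 2 / 2)) := by
  have h := isClassicalNSSolutionOn_shellHost_add_decay ν (U := fun t x => abc (A t) (B t) (C t) x)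
    (S := abc A₁ B₁ C₁) (fun t => isBeltrami_abc _ _ _) (contDiff_uncurry_abc_coeff hA hB hC)
    (fun t => isDivFree_abc _ _ _) (isBeltrami_abc _ _ _) (contDiff_abc _ _ _) (isDivFree_abc _ _ _)
  have hf : (fun t x => timeDerivWithin univ (fun s y => abc (A s) (B s) (C s) y) t x +
        (ν * (1 : ℝ) ^ 2) • abc (A t) (B t) (C t) x) =
      fun t x => abc (deriv A t) (deriv B t) (deriv C t) x + ν • abc (A t) (B t) (C t) x := by
    funext t x
    rw [timeDerivWithin_abc_coeff hA hB hC, one_pow, mul_one]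
  have he : (-((1 : ℝ) ^ 2 * ν)) = -ν := by ring
  rw [hf, he] at h
  exact h

end Summit.NavierStokesRegularity.FluidComputer.TimeDependentShellHost
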